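import Summits.ResolutionOfSingularities.ResolutionOfSingularities.Theorems.PurelyInseparableDim4ResConeLightFreeKernel
import Summits.ResolutionOfSingularities.ResolutionOfSingularities.Theorems.PurelyInseparableDim4ResConeLightKernelTransport
import Summits.ResolutionOfSingularities.ResolutionOfSingularities.Theorems.PurelyInseparableDim4ResConeLightLossyTransport
import HarnessLib
import HarnessLib.Audit.Tags

/-!
# Purely inseparable four-folds — ONE STEP OF THE LOSS-FREE VIRTUAL CHAIN shadowing a light `(5,3)` binary-cone chain: the
# invariant «free letters correspond, light boundary, re-presentation relation at EVERY precision» propagates through a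
# loss-free and through a lossy real step (cell `res-dim4-pi`, K2(p) lane, slice C; light-lossy class = hN4-C, FILE 4a)

[OURS · counted 0 · cell `res-dim4-pi` · K2(p) lane (holder res-dim4-p-12 g4; route of record «LIGHT-LOSSY = C13 ∘
RE-PRESENTATION (hN4-C)», res-dim4-idea-1 g7) · seat res-dim4-p-1 g5.]  Nothing here proves K2(5)
(`RidgeBudget.NoAboveFloorTrap 5 5`), `NoIsolatedTrap 5 5` or resolution of singularities in dimension ≥ 4 / characteristic
`p` — NOT proved.  AI kernel work, weaker than expert review.

The INVARIANT of the virtual chain at a real time `k ≥ k₀` of a light `(5,3)` binary-cone chain `c` (isolated, witnessed,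
`x^{r₀} ∣ F₀`, above floor, shade `≡ 3`, `e_G ≡ 2`, weights `≤ 1`, `|r| = 3`): a letter bijection `π` and a fixed free letter `φ`
with `(c k).r (π φ) = 0`, a virtual state `B` with light boundary `B.r = 𝟙 − e_φ`, and FOR EVERY PRECISION `M` a one-free-letter
unit-class relation `ℛ_π((c k).F, B.F)` at precision `M` (the relation may depend on `M`; `B` does not).
* §1 `real_facts`, **`read_of_inv`** — the invariant makes `B` isolated of order `6` with `e_G(B) = 2`
  (`SwapNorm.read_of_rel`, FILE 2 `LightRep.finrank_resVertex_eq`, at a precision past the certificate of `c k`).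
* §2 **`exists_virtual_translation`** — the real direction, moved to the line `e_{πℓ} + K·e_{πφ}` (loss-free step: as is; lossy
  step translating `x = π ℓ` by `τ′`: the partner direction `e_x + τ·e_{πφ}`, `τ τ′ = 1`), has a partner `e_ℓ + γ′·e_φ ∈
  resVertex B` (FILE 2) — so the kernel-chosen translation of the virtual chain exists.
* §3 **`inv_step_lossfree`**, **`inv_step_lossy`** — for ANY such `γ′` the virtual step `step_ℓ(γ′·e_φ) B` carries the invariant
  to time `k + 1` (bijection `π` resp. `π ∘ swap(x, πφ)`): FILE 1 `translation_unique_of_light` + FILE 2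
  `jet_relation_of_mem_resVertex` give the 1-jet relation for EVERY relation at precision `M + 5`, and
  `SwapTransport.unitFrame_step` (res-dim4-p-11 g3) resp. FILE 3 `rel_lossy_step` return precision `M`.
[cite: Hauser2010, §§F–G] [cite: CossartJannsenSaito2020, Thm. 3.14] bears_on: LADDER-RESOLUTION:D157-DOOR2 (res-dim4-pi ·
K2(p) · slice C · light-lossy (5,3) = hN4-C · FILE 4a).  Supports stmt-ResolutionOfSingularities-16155 (helper).
-/

set_option linter.dupNamespace false -- mandated namespace of this single-conjunct summit

noncomputable section

namespace Summit.ResolutionOfSingularities.ResolutionOfSingularities.Theorems.PIDim4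

namespace ResCone

namespace LightRep

open MvPolynomial Finset
open Literature.AlgebraicGeometry.Resolution
open Literature.AlgebraicGeometry.Resolution.CentreBlowup
open Literature.AlgebraicGeometry.Resolution.Hauser2010
open Literature.AlgebraicGeometry.Resolution.HauserPerlega2019
open PointBlowup (polarMap additiveSubspace direction)

variable {K : Type} [Field K] [CharP K 5] [DecidableEq K]

/-! ## 1. Reading the invariant -/

omit [CharP K 5] in
/-- Facts of the real light state: order `6`, `x^r ∣ F`, the boundary in the `𝟙 − e_y` dress, order `≥ 5` along the point.
[OURS · bookkeeping] -/
theorem real_facts {c : ℕ → State K} {j : ℕ → Fin 4} {b : ℕ → Fin 4 → K}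
    (hc : ∀ k, IsIsolated 5 (c k).F ∧ Step0 5 (c k) (c (k + 1))) (hw : FreeTail.IsWitnessedChain 5 c j b)
    (hr0 : ∀ e ∈ (c 0).F.support, (c 0).r ≤ e) (hfloor : ∀ k, ordZero (c k).F ≠ 5) {k₀ : ℕ}
    (hshade : ∀ k, k₀ ≤ k → (c k).shade = ((3 : ℕ) : ℕ∞))
    (hlight : ∀ k, k₀ ≤ k → (∀ i, (c k).r i ≤ 1) ∧ (c k).r.degree = 3) {k : ℕ} (hk : k₀ ≤ k) {y : Fin 4}
    (hy : (c k).r y = 0) :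
    ordZero (c k).F = ((6 : ℕ) : ℕ∞) ∧ (∀ d ∈ (c k).F.support, (c k).r ≤ d) ∧
      (∀ i, (c k).r i = if i = y then 0 else 1) ∧ (5 : ℕ∞) ≤ ordAlong Finset.univ (c k).F := by
  haveI : Fact (Nat.Prime 5) := ⟨by norm_num⟩
  obtain ⟨hord, -, -, -, -⟩ := three_weights_laws hc hw hr0 hfloor hshade
  refine ⟨by rw [hord k hk, (hlight k hk).2], IsolatedBand.isolated_chain_forall_le hc hr0 k, fun i => ?_,
    by exact_mod_cast (hw k).1⟩
  by_cases hiy : i = y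
  · rw [if_pos hiy, hiy, hy]
  · rw [if_neg hiy]; exact apply_eq_one_of_light (hlight k hk).1 (hlight k hk).2 hy hiy

/-- **READING THE INVARIANT**: the virtual state is isolated of order `6` with `e_G = 2`. [OURS]
[cite: CossartJannsenSaito2020, Def. 2.18, Thm. 3.14] -/
theorem read_of_inv {c : ℕ → State K} {j : ℕ → Fin 4} {b : ℕ → Fin 4 → K}
    (hc : ∀ k, IsIsolated 5 (c k).F ∧ Step0 5 (c k) (c (k + 1))) (hw : FreeTail.IsWitnessedChain 5 c j b)
    (hr0 : ∀ e ∈ (c 0).F.support, (c 0).r ≤ e) (hfloor : ∀ k, ordZero (c k).F ≠ 5) {k₀ : ℕ}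
    (hshade : ∀ k, k₀ ≤ k → (c k).shade = ((3 : ℕ) : ℕ∞))
    (he : ∀ k, k₀ ≤ k → Module.finrank K (resVertex (c k)) = 2)
    (hlight : ∀ k, k₀ ≤ k → (∀ i, (c k).r i ≤ 1) ∧ (c k).r.degree = 3) {k : ℕ} (hk : k₀ ≤ k)
    {π : Equiv.Perm (Fin 4)} {φ : Fin 4} (hφ : (c k).r (π φ) = 0) {B : State K}
    (hrB : ∀ i, B.r i = if i = φ then 0 else 1)
    (hrel : ∀ M : ℕ, ∃ (θ e : Fin 4 → MvPolynomial (Fin 4) K) (G U E : MvPolynomial (Fin 4) K),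
      (∀ i, i ≠ φ → θ (π i) = X i * e i) ∧ θ (π φ) = X φ * e φ + G ∧ (∀ i, constantCoeff (e i) ≠ 0) ∧
      constantCoeff G = 0 ∧ coeff (Finsupp.single φ 1) G = 0 ∧ constantCoeff U ≠ 0 ∧ E ∈ originIdeal K ^ M ∧
      B.F = deletePthPowers 5 (U ^ 5 * aeval θ (c k).F) + E) :
    IsIsolated 5 B.F ∧ ordZero B.F = ((6 : ℕ) : ℕ∞) ∧ Module.finrank K (resVertex B) = 2 := by
  haveI : Fact (Nat.Prime 5) := ⟨by norm_num⟩
  obtain ⟨ho, hrA, hrA', -⟩ := real_facts hc hw hr0 hfloor hshade hlight hk hφ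
  obtain ⟨N, hN⟩ := IsolationConverse.exists_certificate_of_isIsolated (hc k).1
  obtain ⟨θ, e, G, U, E, hθi, hθf, hei, hG0, hG1, hU, hE, hreln⟩ := hrel (N + 7)
  have hrBm := r_eq_mapDomain_of_light hrB hrA'
  obtain ⟨hiso, hoB⟩ := SwapNorm.read_of_rel 5 hθi hθf hei hG0 hG1 hU hE hreln (hc k).1 hN (by omega) ho
    (by norm_num) (by omega)
  exact ⟨hiso, hoB, (finrank_resVertex_eq 5 hθi hθf hei hG0 hG1 hU hE hreln ho (by norm_num) (by omega) hrA hφ hrBm).trans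
    (he k hk)⟩

/-! ## 2. The virtual translation exists -/

omit [CharP K 5] in
/-- **A kernel partner of a real kernel direction on the line `e_{πℓ} + K·e_{πφ}`** (FILE 2 at precision `7`). [OURS] -/
theorem exists_virtual_translation {c : ℕ → State K} {j : ℕ → Fin 4} {b : ℕ → Fin 4 → K}
    (hc : ∀ k, IsIsolated 5 (c k).F ∧ Step0 5 (c k) (c (k + 1))) (hw : FreeTail.IsWitnessedChain 5 c j b)
    (hr0 : ∀ e ∈ (c 0).F.support, (c 0).r ≤ e) (hfloor : ∀ k, ordZero (c k).F ≠ 5) {k₀ : ℕ}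
    (hshade : ∀ k, k₀ ≤ k → (c k).shade = ((3 : ℕ) : ℕ∞))
    (hlight : ∀ k, k₀ ≤ k → (∀ i, (c k).r i ≤ 1) ∧ (c k).r.degree = 3) {k : ℕ} (hk : k₀ ≤ k)
    {π : Equiv.Perm (Fin 4)} {φ : Fin 4} (hφ : (c k).r (π φ) = 0) {B : State K}
    (hrB : ∀ i, B.r i = if i = φ then 0 else 1)
    (hrel : ∀ M : ℕ, ∃ (θ e : Fin 4 → MvPolynomial (Fin 4) K) (G U E : MvPolynomial (Fin 4) K),
      (∀ i, i ≠ φ → θ (π i) = X i * e i) ∧ θ (π φ) = X φ * e φ + G ∧ (∀ i, constantCoeff (e i) ≠ 0) ∧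
      constantCoeff G = 0 ∧ coeff (Finsupp.single φ 1) G = 0 ∧ constantCoeff U ≠ 0 ∧ E ∈ originIdeal K ^ M ∧
      B.F = deletePthPowers 5 (U ^ 5 * aeval θ (c k).F) + E)
    {ℓ : Fin 4} (hℓφ : ℓ ≠ φ) {γ : K}
    (hγA : (Pi.single (π ℓ) 1 : Fin 4 → K) + γ • (Pi.single (π φ) 1 : Fin 4 → K) ∈ resVertex (c k)) :
    ∃ γ' : K, (Pi.single ℓ 1 : Fin 4 → K) + γ' • (Pi.single φ 1 : Fin 4 → K) ∈ resVertex B := by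
  haveI : Fact (Nat.Prime 5) := ⟨by norm_num⟩
  obtain ⟨ho, hrA, hrA', -⟩ := real_facts hc hw hr0 hfloor hshade hlight hk hφ
  obtain ⟨θ, e, G, U, E, hθi, hθf, hei, hG0, hG1, hU, hE, hreln⟩ := hrel 7
  exact exists_translation_mem_resVertex 5 hθi hθf hei hG0 hG1 hU hE hreln ho (by norm_num) (by norm_num) hrA hφ
    (r_eq_mapDomain_of_light hrB hrA') hℓφ hγA

/-! ## 3. The invariant through one real step -/

/-- **LOSS-FREE REAL STEP** (`(c k).r (j k) = 1`): with `ℓ = π⁻¹ (j k)` and ANY `γ′` with `e_ℓ + γ′·e_φ ∈ resVertex B`, the virtual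
step `step_ℓ(γ′·e_φ) B` carries the invariant to `k + 1` along the same `π`. [OURS] [cite: Hauser2010, §§F–G]
[cite: CossartJannsenSaito2020, Thm. 3.14] -/
theorem inv_step_lossfree {c : ℕ → State K} {j : ℕ → Fin 4} {b : ℕ → Fin 4 → K}
    (hc : ∀ k, IsIsolated 5 (c k).F ∧ Step0 5 (c k) (c (k + 1))) (hw : FreeTail.IsWitnessedChain 5 c j b)
    (hr0 : ∀ e ∈ (c 0).F.support, (c 0).r ≤ e) (hfloor : ∀ k, ordZero (c k).F ≠ 5) {k₀ : ℕ}
    (hshade : ∀ k, k₀ ≤ k → (c k).shade = ((3 : ℕ) : ℕ∞))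
    (he : ∀ k, k₀ ≤ k → Module.finrank K (resVertex (c k)) = 2)
    (hlight : ∀ k, k₀ ≤ k → (∀ i, (c k).r i ≤ 1) ∧ (c k).r.degree = 3) {k : ℕ} (hk : k₀ ≤ k)
    {π : Equiv.Perm (Fin 4)} {φ : Fin 4} (hφ : (c k).r (π φ) = 0) {B : State K}
    (hrB : ∀ i, B.r i = if i = φ then 0 else 1)
    (hrel : ∀ M : ℕ, ∃ (θ e : Fin 4 → MvPolynomial (Fin 4) K) (G U E : MvPolynomial (Fin 4) K),
      (∀ i, i ≠ φ → θ (π i) = X i * e i) ∧ θ (π φ) = X φ * e φ + G ∧ (∀ i, constantCoeff (e i) ≠ 0) ∧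
      constantCoeff G = 0 ∧ coeff (Finsupp.single φ 1) G = 0 ∧ constantCoeff U ≠ 0 ∧ E ∈ originIdeal K ^ M ∧
      B.F = deletePthPowers 5 (U ^ 5 * aeval θ (c k).F) + E)
    (hj1 : (c k).r (j k) = 1) {ℓ : Fin 4} (hℓ : π ℓ = j k) :
    ℓ ≠ φ ∧ (∃ γ' : K, (Pi.single ℓ 1 : Fin 4 → K) + γ' • (Pi.single φ 1 : Fin 4 → K) ∈ resVertex B) ∧
    ∀ γ' : K, (Pi.single ℓ 1 : Fin 4 → K) + γ' • (Pi.single φ 1 : Fin 4 → K) ∈ resVertex B →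
      (c (k + 1)).r (π φ) = 0 ∧
      (∀ i, (CentreBlowup.step 5 Finset.univ ℓ (Pi.single φ γ' : Fin 4 → K) B).r i = if i = φ then 0 else 1) ∧
      ∀ M : ℕ, ∃ (θ e : Fin 4 → MvPolynomial (Fin 4) K) (G U E : MvPolynomial (Fin 4) K),
        (∀ i, i ≠ φ → θ (π i) = X i * e i) ∧ θ (π φ) = X φ * e φ + G ∧ (∀ i, constantCoeff (e i) ≠ 0) ∧
        constantCoeff G = 0 ∧ coeff (Finsupp.single φ 1) G = 0 ∧ constantCoeff U ≠ 0 ∧ E ∈ originIdeal K ^ M ∧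
        (CentreBlowup.step 5 Finset.univ ℓ (Pi.single φ γ' : Fin 4 → K) B).F =
          deletePthPowers 5 (U ^ 5 * aeval θ (c (k + 1)).F) + E := by
  haveI : Fact (Nat.Prime 5) := ⟨by norm_num⟩
  obtain ⟨ho, hrA, hrA', hA5⟩ := real_facts hc hw hr0 hfloor hshade hlight hk hφ
  obtain ⟨-, hlaw, hbj, -, -⟩ := three_weights_laws hc hw hr0 hfloor hshade
  obtain ⟨-, hoB, -⟩ := read_of_inv hc hw hr0 hfloor hshade he hlight hk hφ hrB hrel
  have hB5 : (5 : ℕ∞) ≤ ordAlong Finset.univ B.F := by rw [ordAlong_univ, hoB]; exact_mod_cast (by norm_num : 5 ≤ 6)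
  have hB6 : ordAlong Finset.univ B.F = ((5 + 1 : ℕ) : ℕ∞) := by rw [ordAlong_univ, hoB]
  -- letters
  have hjφ : j k ≠ π φ := fun h => by rw [h, hφ] at hj1; exact zero_ne_one hj1
  have hℓφ : ℓ ≠ φ := fun h => hjφ (by rw [← hℓ, h])
  -- the real translation is supported on the free letter
  rcases light_step_cases hc hw hr0 hfloor hshade hlight hk with ⟨-, hno⟩ | ⟨hj0, -⟩
  swap
  · rw [hj1] at hj0; exact absurd hj0 one_ne_zero
  have hb : ∀ i, i ≠ π φ → b k i = 0 := by
    intro i hi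
    by_contra hbi
    have h := hno i hbi
    rw [hrA' i, if_neg hi] at h
    exact one_ne_zero h
  have hbfun : b k = (Pi.single (π φ) (b k (π φ)) : Fin 4 → K) := by
    funext i
    by_cases hi : i = π φ
    · rw [hi, Pi.single_eq_same]
    · rw [Pi.single_eq_of_ne hi, hb i hi]
  have hchild : c (k + 1) = CentreBlowup.step 5 Finset.univ (π ℓ) (Pi.single (π φ) (b k (π φ)) : Fin 4 → K) (c k) := by
    rw [(hw k).2.2.2.2, ← hbfun, hℓ]
  -- the real direction on the line `e_{πℓ} + K·e_{πφ}`
  have hγA : (Pi.single (π ℓ) 1 : Fin 4 → K) + b k (π φ) • (Pi.single (π φ) 1 : Fin 4 → K) ∈ resVertex (c k) := by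
    have h := chain_direction_mem_resVertex 5 hc hw hr0 hfloor hshade hk
    rwa [direction_eq_of_support (hbj k) hb, ← hℓ] at h
  have huniq : ∀ γ₁ γ₂ : K, (Pi.single (π ℓ) 1 : Fin 4 → K) + γ₁ • (Pi.single (π φ) 1 : Fin 4 → K) ∈ resVertex (c k) →
      (Pi.single (π ℓ) 1 : Fin 4 → K) + γ₂ • (Pi.single (π φ) 1 : Fin 4 → K) ∈ resVertex (c k) → γ₁ = γ₂ :=
    fun γ₁ γ₂ h₁ h₂ => translation_unique_of_light hc hw hr0 hfloor hshade he hlight hk hφ h₁ h₂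
  refine ⟨hℓφ, exists_virtual_translation hc hw hr0 hfloor hshade hlight hk hφ hrB hrel hℓφ hγA, fun γ' hγ' => ⟨?_, ?_, ?_⟩⟩
  · -- the free letter of `c (k+1)` is still `π φ`
    have h := law_apply (r := fun k => (c k).r) (hlaw k hk) (π φ)
    simp only [if_neg (Ne.symm hjφ)] at h
    by_cases hb0 : b k (π φ) = 0
    · rw [if_pos hb0] at h; exact h.trans hφ
    · rw [if_neg hb0] at h; exact h
  · exact step_r_apply_of_light 5 hℓφ hrB hB6 γ'
  · intro M
    obtain ⟨θ, e, G, U, E, hθi, hθf, hei, hG0, hG1, hU, hE, hreln⟩ := hrel (M + 7)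
    have hγ := jet_relation_of_mem_resVertex 5 hθi hθf hei hG0 hG1 hU hE hreln ho (by norm_num) (by omega) hrA hφ
      (r_eq_mapDomain_of_light hrB hrA') hℓφ huniq hγA hγ'
    obtain ⟨θ', e', G', U', E', h1, h2, h3, h4, h5, h6, h7, h8⟩ :=
      SwapTransport.unitFrame_step 5 π φ hθi hθf hei hG0 hG1 hU hE hreln hA5 hB5 hℓφ hγ
    refine ⟨θ', e', G', U', E', h1, h2, h3, h4, h5, h6, Ideal.pow_le_pow_right (by omega) h7, ?_⟩
    rw [hchild]
    exact h8

/-- **LOSSY REAL STEP** (`(c k).r (j k) = 0`, a boundary letter `x` translated, `b k x ≠ 0`): with `ℓ = π⁻¹ x` and ANY `γ′` with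
`e_ℓ + γ′·e_φ ∈ resVertex B`, the virtual step `step_ℓ(γ′·e_φ) B` carries the invariant to `k + 1` along `π ∘ swap(x, πφ)` (the new
free letter of the real chain is `x`). [OURS] [cite: Hauser2010, §§F–G] [cite: CossartJannsenSaito2020, Thm. 3.14]
[cite: HauserPerlega2019PRIMS, §2 (transform D′ of D)] -/
theorem inv_step_lossy {c : ℕ → State K} {j : ℕ → Fin 4} {b : ℕ → Fin 4 → K}
    (hc : ∀ k, IsIsolated 5 (c k).F ∧ Step0 5 (c k) (c (k + 1))) (hw : FreeTail.IsWitnessedChain 5 c j b)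
    (hr0 : ∀ e ∈ (c 0).F.support, (c 0).r ≤ e) (hfloor : ∀ k, ordZero (c k).F ≠ 5) {k₀ : ℕ}
    (hshade : ∀ k, k₀ ≤ k → (c k).shade = ((3 : ℕ) : ℕ∞))
    (he : ∀ k, k₀ ≤ k → Module.finrank K (resVertex (c k)) = 2)
    (hlight : ∀ k, k₀ ≤ k → (∀ i, (c k).r i ≤ 1) ∧ (c k).r.degree = 3) {k : ℕ} (hk : k₀ ≤ k)
    {π : Equiv.Perm (Fin 4)} {φ : Fin 4} (hφ : (c k).r (π φ) = 0) {B : State K}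
    (hrB : ∀ i, B.r i = if i = φ then 0 else 1)
    (hrel : ∀ M : ℕ, ∃ (θ e : Fin 4 → MvPolynomial (Fin 4) K) (G U E : MvPolynomial (Fin 4) K),
      (∀ i, i ≠ φ → θ (π i) = X i * e i) ∧ θ (π φ) = X φ * e φ + G ∧ (∀ i, constantCoeff (e i) ≠ 0) ∧
      constantCoeff G = 0 ∧ coeff (Finsupp.single φ 1) G = 0 ∧ constantCoeff U ≠ 0 ∧ E ∈ originIdeal K ^ M ∧
      B.F = deletePthPowers 5 (U ^ 5 * aeval θ (c k).F) + E)
    (hj0 : (c k).r (j k) = 0) {x : Fin 4} (hbx : b k x ≠ 0) {ℓ : Fin 4} (hℓ : π ℓ = x) :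
    ℓ ≠ φ ∧ (∃ γ' : K, (Pi.single ℓ 1 : Fin 4 → K) + γ' • (Pi.single φ 1 : Fin 4 → K) ∈ resVertex B) ∧
    ∀ γ' : K, (Pi.single ℓ 1 : Fin 4 → K) + γ' • (Pi.single φ 1 : Fin 4 → K) ∈ resVertex B →
      (c (k + 1)).r ((π.trans (Equiv.swap x (π φ))) φ) = 0 ∧
      (∀ i, (CentreBlowup.step 5 Finset.univ ℓ (Pi.single φ γ' : Fin 4 → K) B).r i = if i = φ then 0 else 1) ∧
      ∀ M : ℕ, ∃ (θ e : Fin 4 → MvPolynomial (Fin 4) K) (G U E : MvPolynomial (Fin 4) K),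
        (∀ i, i ≠ φ → θ ((π.trans (Equiv.swap x (π φ))) i) = X i * e i) ∧
        θ ((π.trans (Equiv.swap x (π φ))) φ) = X φ * e φ + G ∧ (∀ i, constantCoeff (e i) ≠ 0) ∧
        constantCoeff G = 0 ∧ coeff (Finsupp.single φ 1) G = 0 ∧ constantCoeff U ≠ 0 ∧ E ∈ originIdeal K ^ M ∧
        (CentreBlowup.step 5 Finset.univ ℓ (Pi.single φ γ' : Fin 4 → K) B).F =
          deletePthPowers 5 (U ^ 5 * aeval θ (c (k + 1)).F) + E := by
  haveI : Fact (Nat.Prime 5) := ⟨by norm_num⟩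
  subst hℓ
  obtain ⟨ho, hrA, hrA', hA5⟩ := real_facts hc hw hr0 hfloor hshade hlight hk hφ
  obtain ⟨-, -, hbj, -, -⟩ := three_weights_laws hc hw hr0 hfloor hshade
  obtain ⟨-, hoB, -⟩ := read_of_inv hc hw hr0 hfloor hshade he hlight hk hφ hrB hrel
  have hB5 : (5 : ℕ∞) ≤ ordAlong Finset.univ B.F := by rw [ordAlong_univ, hoB]; exact_mod_cast (by norm_num : 5 ≤ 6)
  have hB6 : ordAlong Finset.univ B.F = ((5 + 1 : ℕ) : ℕ∞) := by rw [ordAlong_univ, hoB]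
  -- letters: the chart letter is the free letter `π φ`, the translated letter `x` is a boundary letter
  have hjφ : j k = π φ := by
    by_contra h
    have h1 := hrA' (j k)
    rw [if_neg h, hj0] at h1
    exact zero_ne_one h1
  have hxφ' : π ℓ ≠ π φ := fun h => hbx (by rw [h, ← hjφ]; exact hbj k)
  have hℓφ : ℓ ≠ φ := fun h => hxφ' (by rw [h])
  have hrx : (c k).r (π ℓ) = 1 := by rw [hrA' (π ℓ), if_neg hxφ']
  obtain ⟨-, hothers, hx0, -⟩ := lossy_step_shape hc hw hr0 hfloor hshade hlight hk hbx hrx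
  have hb : ∀ i, i ≠ π ℓ → b k i = 0 := by
    intro i hix
    by_cases hi : i = π φ
    · rw [hi, ← hjφ]; exact hbj k
    · by_contra hbi
      have h := hothers i hix hbi
      rw [hrA' i, if_neg hi] at h
      exact one_ne_zero h
  have hbfun : b k = (Pi.single (π ℓ) (b k (π ℓ)) : Fin 4 → K) := by
    funext i
    by_cases hi : i = π ℓ
    · rw [hi, Pi.single_eq_same]
    · rw [Pi.single_eq_of_ne hi, hb i hi]
  have hchild : c (k + 1) =
      CentreBlowup.step 5 Finset.univ (π φ) (Pi.single (π ℓ) (b k (π ℓ)) : Fin 4 → K) (c k) := by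
    rw [(hw k).2.2.2.2, ← hjφ, ← hbfun]
  -- the partner direction `e_x + τ·e_{πφ}`, `τ = (b k x)⁻¹`, lies in the kernel
  have hττ' : (b k (π ℓ))⁻¹ * b k (π ℓ) = 1 := inv_mul_cancel₀ hbx
  have hγA : (Pi.single (π ℓ) 1 : Fin 4 → K) + (b k (π ℓ))⁻¹ • (Pi.single (π φ) 1 : Fin 4 → K) ∈ resVertex (c k) := by
    have h := chain_direction_mem_resVertex 5 hc hw hr0 hfloor hshade hk
    rw [hjφ, direction_eq_of_support (hjφ ▸ hbj k) hb] at h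
    have h' := Submodule.smul_mem _ (b k (π ℓ))⁻¹ h
    rwa [smul_add, smul_smul, hττ', one_smul, add_comm] at h'
  have huniq : ∀ γ₁ γ₂ : K, (Pi.single (π ℓ) 1 : Fin 4 → K) + γ₁ • (Pi.single (π φ) 1 : Fin 4 → K) ∈ resVertex (c k) →
      (Pi.single (π ℓ) 1 : Fin 4 → K) + γ₂ • (Pi.single (π φ) 1 : Fin 4 → K) ∈ resVertex (c k) → γ₁ = γ₂ :=
    fun γ₁ γ₂ h₁ h₂ => translation_unique_of_light hc hw hr0 hfloor hshade he hlight hk hφ h₁ h₂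
  refine ⟨hℓφ, exists_virtual_translation hc hw hr0 hfloor hshade hlight hk hφ hrB hrel hℓφ hγA, fun γ' hγ' => ⟨?_, ?_, ?_⟩⟩
  · -- the free letter of `c (k+1)` is `x = swap x (πφ) (π φ)`
    rw [Equiv.trans_apply, Equiv.swap_apply_right]
    exact hx0
  · exact step_r_apply_of_light 5 hℓφ hrB hB6 γ'
  · intro M
    obtain ⟨θ, e, G, U, E, hθi, hθf, hei, hG0, hG1, hU, hE, hreln⟩ := hrel (M + 7)
    have hγ := jet_relation_of_mem_resVertex 5 hθi hθf hei hG0 hG1 hU hE hreln ho (by norm_num) (by omega) hrA hφ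
      (r_eq_mapDomain_of_light hrB hrA') hℓφ huniq hγA hγ'
    obtain ⟨θ', e', G', U', E', h1, h2, h3, h4, h5, h6, h7, h8⟩ :=
      rel_lossy_step 5 π φ hθi hθf hei hG0 hG1 hU hE hreln hA5 hB5 hℓφ hττ' hγ (by omega)
    refine ⟨θ', e', G', U', E', h1, h2, h3, h4, h5, h6, Ideal.pow_le_pow_right (by omega) h7, ?_⟩
    rw [hchild]
    exact h8

end LightRep

end ResCone

end Summit.ResolutionOfSingularities.ResolutionOfSingularities.Theorems.PIDim4

end
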